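import Literature.MeasureTheory.Group.OrbitalIntegralKernelDecompositionStratum   -- ★ FILE A (p849206): the stratum step `exists_mem_span_conj_sub_eqOn_of_orbitalIntegral_eq_zero`
import HarnessLib

/-!
# The kernel of the orbital integrals on a finite closed filtration by conjugacy classes is `C₀ +` (functions vanishing near the classes)
# — the Howe ∕ Harish-Chandra induction behind «invariant distributions supported on the unipotent variety are spanned by the unipotent orbital integrals»

Topic `MeasureTheory/Group`; namespace `Literature.MeasureTheory.Group`.  THEOREMS ONLY (no definition, no instance, no notation, no named fact, no `sorry`).
GENERIC: `G` a locally compact, Hausdorff, totally disconnected, second countable topological group.  ORGAN SPAN-e «SPAN-ASSEMBLY» of the LH4 Shalika pay-down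
(cell `pub/hodgecm-mathlib`, crux H413 = `stmt-HodgeConjecture-24833`, print row `stub_N6nsShalika` = ★ def `ShalikaGermExpansionNonsplit`, [Rogawski1990, Prop. 8.1.1
p. 112]; skeleton `StubN6nsShalika.paydown.skeleton.v1` a42538b5, organ `stub_ShSpan` :156–:178 = this file's HEAD at `P γ := (γ − 1)³ = 0`).

THE STATEMENT ([Rogawski1990, p. 113 ll. 7–20] after [Howe1974, Prop. 2]; [HarishChandra1999AdmissibleDistributions, Thm. 8.1]; [BernsteinZelevinsky1976, §1]).  Let `P` be a
conjugation-invariant predicate whose classes form a finite set `S` admitting an enumeration `e : Fin n → S` with every initial union `Z_k = ⋃_{i<k} 𝒪(e i)` CLOSED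
(a closed filtration: each stratum `𝒪(e k) ∖ Z_k` is one class, open in `Z_{k+1}`), `m_U` an orbital-measure family admissible on `S` with the Ranga-Rao clause (every
`f ∈ C_c^∞(G)` has an integrable orbital integrand at every class of `S`).  Then every `F ∈ C_c^∞(G)` ALL OF WHOSE `S`-ORBITAL INTEGRALS VANISH is `F = F₀ + F₁` with
`F₀ ∈ C₀ := span{φ^x − φ : φ ∈ C_c^∞(G), x ∈ G}` and `tsupport F₁` disjoint from `{P}` (`exists_add_mem_span_conj_sub_of_classOrbitalIntegral_eq_zero`).
For `G = U(Φ₃)(L⁺_v)` and `P γ := (γ − 1)³ = 0` (four unipotent classes `{1} ⊂ {(γ−1)² = 0} ⊂ {(γ−1)³ = 0}`) this is HOWE'S SPAN PROPERTY, conjunct (vi) of the ★ SH-3 plug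
`UnitaryGroup.shalikaGermExpansionNonsplit_of_howePackage`.

THE PROOF (direct induction on `k`, ★ FILE A for the step).  I(k): `F = F₀ + F₁`, `F₀ ∈ C₀`, `F₁ ∈ C_c^∞`, `tsupport F₁ ∩ Z_k = ∅`.  I(0) is `F = 0 + F`.  I(k) ⇒ I(k+1):
if the class `u = e k` already occurs below `k` then `Z_{k+1} = Z_k`; otherwise `𝒪(u) = Z_{k+1} ∖ Z_k` is locally closed and disjoint from the closed invariant `Z_k`,
`Φ(u, F₁) = Φ(u, F) − Φ(u, F₀) = 0` (★ SH-2 `classOrbitalIntegral_eq_zero_of_mem_span_conj_sub_of_mem`, additivity under the Rao clause), so ★ FILE A gives `Ψ ∈ C₀`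
with `Ψ = F₁` on `𝒪(u)` and `tsupport Ψ ∩ Z_k = ∅`; then `F = (F₀ + Ψ) + (F₁ − Ψ)` and `F₁ − Ψ` is locally constant and vanishes ON `𝒪(u)`, hence NEAR `𝒪(u)`, and near
`Z_k`.  I(n) is the head since `Z_n = {P}` (`hS`, `hP`).
HONEST LABEL: pure measure theory ∕ topology, count-neutral; HC_CM is proved only modulo the 7 printed citations (2 remaining: hLiu418 = stmt-HodgeConjecture-24832,
h413 = stmt-HodgeConjecture-24833) until rung 0 closes; the organ TIE at the Shalika skeleton is the dealer's (LH4-plan) 5-line `exact`.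

## References
* [Rogawski1990] J. D. Rogawski, *Automorphic Representations of Unitary Groups in Three Variables*, Ann. of Math. Stud. 123 (1990): §8.1, proof of Prop. 8.1.1 p. 113.
* [Howe1974] R. Howe, *The Fourier transform and germs of characters (case of Gl_n over a p-adic field)*, Math. Ann. 208 (1974) 305–322: Prop. 2.
* [HarishChandra1999AdmissibleDistributions] Harish-Chandra (DeBacker–Sally), *Admissible Invariant Distributions on Reductive p-adic Groups*, AMS ULS 16 (1999): Thm. 8.1 p. 48,
  §3.1 p. 17.
* [BernsteinZelevinsky1976] I. N. Bernstein, A. V. Zelevinsky, *Representations of the group GL(n, F) where F is a non-archimedean local field*, Russian Math. Surveys 31:3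
  (1976): §1 (§1.5 orbits, Prop. 1.8, §1.18).
-/

set_option autoImplicit false

noncomputable section

open Set Filter Topology MulAction MeasureTheory MeasureTheory.Measure
open Literature.NumberTheory.Rogawski1990 Literature.NumberTheory.Automorphic Literature.Topology
open scoped Pointwise

namespace Literature.MeasureTheory.Group

section Induction

variable {G : Type*} [Group G] [TopologicalSpace G] [IsTopologicalGroup G] [LocallyCompactSpace G] [T2Space G]
  [TotallyDisconnectedSpace G] [SecondCountableTopology G] [MeasurableSpace G] [BorelSpace G]
  [∀ γ : G, MeasurableSpace (G ⧸ Subgroup.centralizer ({γ} : Set G))] [∀ γ : G, BorelSpace (G ⧸ Subgroup.centralizer ({γ} : Set G))]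

omit [Group G] [IsTopologicalGroup G] [LocallyCompactSpace G] [T2Space G] [TotallyDisconnectedSpace G] [SecondCountableTopology G] [MeasurableSpace G]
  [BorelSpace G] [∀ γ : G, MeasurableSpace (G ⧸ Subgroup.centralizer ({γ} : Set G))] [∀ γ : G, BorelSpace (G ⧸ Subgroup.centralizer ({γ} : Set G))] in
/-- A locally constant function vanishing AT a point vanishes NEAR it: the point is off the topological support. [cite: BernsteinZelevinsky1976, §1.1] -/
theorem notMem_tsupport_of_isLocallyConstant_of_apply_eq_zero {F : G → ℂ} (hF : IsLocallyConstant F) {g : G} (hg : F g = 0) :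
    g ∉ tsupport F := by
  rw [notMem_tsupport_iff_eventuallyEq]
  exact (hF.eventually_eq g).mono fun y hy => by rw [Pi.zero_apply, hy, hg]

omit [TopologicalSpace G] [IsTopologicalGroup G] [LocallyCompactSpace G] [T2Space G] [TotallyDisconnectedSpace G] [SecondCountableTopology G] [MeasurableSpace G]
  [BorelSpace G] [∀ γ : G, MeasurableSpace (G ⧸ Subgroup.centralizer ({γ} : Set G))] [∀ γ : G, BorelSpace (G ⧸ Subgroup.centralizer ({γ} : Set G))] in
/-- The carrier of a conjugacy class is conjugation-invariant. [cite: BernsteinZelevinsky1976, §1.5] -/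
theorem conj_mem_carrier_of_mem {c : ConjClasses G} {g : G} (hg : g ∈ c.carrier) (x : G) : x * g * x⁻¹ ∈ c.carrier := by
  rw [ConjClasses.mem_carrier_iff_mk_eq] at hg ⊢
  rw [← hg, ConjClasses.mk_eq_mk_iff_isConj]
  exact (isConj_iff.2 ⟨x, rfl⟩).symm

/-- **THE INDUCTION ALONG A CLOSED FILTRATION BY CLASSES.**  For every `k`: `F = F₀ + F₁` with `F₀ ∈ C₀`, `F₁ ∈ C_c^∞(G)` and `tsupport F₁` disjoint from
`Z_k = ⋃_{i<k} 𝒪(e i)` — by induction on `k`, the step being ★ FILE A `exists_mem_span_conj_sub_eqOn_of_orbitalIntegral_eq_zero` on the stratum `𝒪(e k) = Z_{k+1} ∖ Z_k`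
(when new), fed by `Φ(e k, F₁) = Φ(e k, F) − Φ(e k, F₀) = 0 − 0` (★ SH-2 under the Rao clause). [cite: Rogawski1990, §8.1 p. 113] [cite: Howe1974, Prop. 2]
[cite: HarishChandra1999AdmissibleDistributions, Thm. 8.1 p. 48] -/
theorem exists_add_mem_span_conj_sub_tsupport_disjoint_filtration (S : Finset (ConjClasses G)) {n : ℕ} (e : Fin n → ConjClasses G)
    (he : ∀ c, c ∈ S ↔ ∃ i, e i = c) (hclosed : ∀ k : ℕ, IsClosed (⋃ (i : Fin n) (_ : i.val < k), (e i).carrier))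
    (mU : OrbitalMeasureFamily G) (hmU : mU.IsAdmissibleOn (fun γ : G => ConjClasses.mk γ ∈ S))
    (hRao : ∀ u ∈ S, ∀ f : G → ℂ, IsLocSmooth f →
      Integrable (descConj (Quotient.out u : G) (Subgroup.centralizer ({(Quotient.out u : G)} : Set G)) (fun _ hg => Subgroup.mem_centralizer_singleton_iff.1 hg) f) (mU u))
    (F : G → ℂ) (hF : IsLocSmooth F) (h0 : ∀ u ∈ S, classOrbitalIntegral mU F u = 0) (k : ℕ) :
    ∃ F₀ F₁ : G → ℂ, F = F₀ + F₁ ∧ F₀ ∈ Submodule.span ℂ {ψ : G → ℂ | ∃ (x : G) (φ : G → ℂ), IsLocSmooth φ ∧ ψ = (fun g => φ (x * g * x⁻¹)) - φ} ∧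
      IsLocSmooth F₁ ∧ Disjoint (tsupport F₁) (⋃ (i : Fin n) (_ : i.val < k), (e i).carrier) := by
  induction k with
  | zero =>
    refine ⟨0, F, (zero_add F).symm, Submodule.zero_mem _, hF, ?_⟩
    simp only [Nat.not_lt_zero, iUnion_of_empty, iUnion_empty, disjoint_empty]
  | succ k ih =>
    obtain ⟨F₀, F₁, hFeq, hF₀, hF₁, hdisj⟩ := ih
    set Zk : Set G := ⋃ (i : Fin n) (_ : i.val < k), (e i).carrier with hZk
    set Zk1 : Set G := ⋃ (i : Fin n) (_ : i.val < k + 1), (e i).carrier with hZk1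
    by_cases hk : k < n
    swap
    · -- no new stratum: `Z_{k+1} ⊆ Z_k`
      refine ⟨F₀, F₁, hFeq, hF₀, hF₁, hdisj.mono_right ?_⟩
      refine iUnion₂_subset fun i hi => ?_
      have hik : i.val < k := lt_of_lt_of_le i.isLt (not_lt.1 hk)
      exact subset_iUnion₂ (s := fun (i : Fin n) (_ : i.val < k) => (e i).carrier) i hik
    · set i₀ : Fin n := ⟨k, hk⟩ with hi₀
      set u : ConjClasses G := e i₀ with hu
      have huS : u ∈ S := (he u).2 ⟨i₀, rfl⟩
      -- `Z_{k+1} = Z_k ∪ 𝒪(u)`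
      have hZ1 : Zk1 = Zk ∪ u.carrier := by
        apply Subset.antisymm
        · refine iUnion₂_subset fun i hi => ?_
          rcases Nat.lt_succ_iff_lt_or_eq.1 hi with hlt | heq
          · exact (subset_iUnion₂ (s := fun (i : Fin n) (_ : i.val < k) => (e i).carrier) i hlt).trans subset_union_left
          · have : i = i₀ := Fin.ext heq
            rw [this]
            exact subset_union_right
        · refine union_subset (iUnion₂_subset fun i hi => ?_) ?_
          · exact subset_iUnion₂ (s := fun (i : Fin n) (_ : i.val < k + 1) => (e i).carrier) i (Nat.lt_succ_of_lt hi)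
          · exact subset_iUnion₂ (s := fun (i : Fin n) (_ : i.val < k + 1) => (e i).carrier) i₀ (Nat.lt_succ_self k)
      by_cases hold : ∃ i : Fin n, i.val < k ∧ e i = u
      · -- the class already occurs below `k`: `Z_{k+1} = Z_k`
        obtain ⟨i, hi, hiu⟩ := hold
        refine ⟨F₀, F₁, hFeq, hF₀, hF₁, hdisj.mono_right ?_⟩
        rw [hZ1]
        refine union_subset Subset.rfl ?_
        rw [← hiu]
        exact subset_iUnion₂ (s := fun (i : Fin n) (_ : i.val < k) => (e i).carrier) i hi
      · -- a NEW stratum `𝒪(u) = Z_{k+1} ∖ Z_k`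
        have hZu : Disjoint Zk u.carrier := by
          refine disjoint_left.2 fun g hg hgu => hold ?_
          obtain ⟨i, hi, hgi⟩ : ∃ i : Fin n, i.val < k ∧ g ∈ (e i).carrier := by
            simpa only [hZk, mem_iUnion, exists_prop] using hg
          exact ⟨i, hi, by rw [← ConjClasses.mem_carrier_iff_mk_eq.1 hgi, ← ConjClasses.mem_carrier_iff_mk_eq.1 hgu]⟩
        -- the stratum data for ★ FILE A at `γ₀ := out u`, `m := mU u`, `Z := Z_k`
        have hout : ConjClasses.mk (Quotient.out u : G) = u := Quotient.out_eq u
        have horb : orbit (ConjAct G) (Quotient.out u : G) = u.carrier := by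
          rw [ConjAct.orbit_eq_carrier_conjClasses, hout]
        have hadm := hmU u (show ConjClasses.mk (Quotient.out u : G) ∈ S by rw [hout]; exact huS)
        haveI : SMulInvariantMeasure G (G ⧸ Subgroup.centralizer ({(Quotient.out u : G)} : Set G)) (mU u) := hadm.2.1
        have hO : IsLocallyClosed (orbit (ConjAct G) (Quotient.out u : G)) := by
          refine ⟨Zkᶜ, Zk1, (hclosed k).isOpen_compl, hclosed (k + 1), ?_⟩
          rw [horb, hZ1, inter_union_distrib_left, compl_inter_self, empty_union]
          exact (inter_eq_right.2 (subset_compl_iff_disjoint_left.2 hZu)).symm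
        have hZinv : ∀ x g : G, g ∈ Zk → x * g * x⁻¹ ∈ Zk := by
          intro x g hg
          obtain ⟨i, hi, hgi⟩ : ∃ i : Fin n, i.val < k ∧ g ∈ (e i).carrier := by
            simpa only [hZk, mem_iUnion, exists_prop] using hg
          exact mem_iUnion₂.2 ⟨i, hi, conj_mem_carrier_of_mem hgi x⟩
        have hZO : Disjoint Zk (orbit (ConjAct G) (Quotient.out u : G)) := by rw [horb]; exact hZu
        have hsupp : tsupport F₁ ∩ closure (orbit (ConjAct G) (Quotient.out u : G)) ⊆ orbit (ConjAct G) (Quotient.out u : G) := by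
          rw [horb]
          intro g ⟨hg1, hg2⟩
          have hsub1 : u.carrier ⊆ Zk1 := by rw [hZ1]; exact subset_union_right
          have hg3 : g ∈ Zk1 := (closure_minimal hsub1 (hclosed (k + 1))) hg2
          rw [hZ1] at hg3
          exact hg3.resolve_left fun h => disjoint_left.1 hdisj hg1 h
        -- `Φ(u, F₁) = Φ(u, F) − Φ(u, F₀) = 0`
        have hF₀sm : IsLocSmooth F₀ := isLocSmooth_of_mem_span_conj_sub hF₀
        have h0u : orbitalIntegral (Quotient.out u : G) F₁ (mU u) = 0 := by
          have hF₁eq : F₁ = F - F₀ := by rw [hFeq]; abel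
          rw [hF₁eq, orbitalIntegral_sub _ _ (hRao u huS F hF) (hRao u huS F₀ hF₀sm)]
          have h1 : orbitalIntegral (Quotient.out u : G) F (mU u) = 0 := h0 u huS
          have h2 : orbitalIntegral (Quotient.out u : G) F₀ (mU u) = 0 :=
            classOrbitalIntegral_eq_zero_of_mem_span_conj_sub_of_mem S hmU hRao huS hF₀
          rw [h1, h2, sub_zero]
        obtain ⟨Ψ, hΨ, hΨeq, hΨZ⟩ := exists_mem_span_conj_sub_eqOn_of_orbitalIntegral_eq_zero (Quotient.out u : G) hO (mU u) hadm.1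
          (hRao u huS) (hclosed k) hZinv hZO hF₁ hsupp h0u
        have hΨsm : IsLocSmooth Ψ := isLocSmooth_of_mem_span_conj_sub hΨ
        refine ⟨F₀ + Ψ, F₁ - Ψ, by rw [hFeq]; abel, Submodule.add_mem _ hF₀ hΨ, ⟨hF₁.1.sub hΨsm.1, hF₁.2.sub hΨsm.2⟩, ?_⟩
        rw [hZ1]
        refine disjoint_left.2 fun g hg hgZ => ?_
        rcases hgZ with hgZk | hgu
        · exact disjoint_left.1 ((disjoint_union_left.2 ⟨hdisj, hΨZ⟩).mono_left (tsupport_sub F₁ Ψ)) hg hgZk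
        · refine notMem_tsupport_of_isLocallyConstant_of_apply_eq_zero (hF₁.1.sub hΨsm.1) ?_ hg
          rw [Pi.sub_apply, hΨeq g (by rw [horb]; exact hgu), sub_self]

/-- **HEAD OF THE ORGAN `stub_ShSpan` (SPAN-e «SPAN-ASSEMBLY»; [Howe1974 Prop. 2] ∕ [HarishChandra1999AdmissibleDistributions Thm. 8.1] on a finite closed filtration by classes).**
`P` a conjugation-invariant predicate, `S` the (finite) set of classes of `P`-elements with an enumeration `e` all of whose initial unions `⋃_{i<k} 𝒪(e i)` are closed, `m_U`
admissible on `S` with the Ranga-Rao clause.  Then every `F ∈ C_c^∞(G)` whose orbital integrals over the classes of `S` vanish decomposes as `F = F₀ + F₁` with `F₀ ∈ C₀ =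
span{φ^x − φ : φ ∈ C_c^∞(G)}` and `tsupport F₁` off `{P}`.  Proof: `exists_add_mem_span_conj_sub_tsupport_disjoint_filtration` at `k = n`, where `⋃_{i<n} 𝒪(e i) = {P}`
by `hS` and the conjugation-invariance `hP`. [cite: Howe1974, Prop. 2] [cite: HarishChandra1999AdmissibleDistributions, Thm. 8.1 p. 48, §3.1 p. 17]
[cite: Rogawski1990, §8.1 pp. 112–113] [cite: BernsteinZelevinsky1976, §1.5] -/
theorem exists_add_mem_span_conj_sub_of_classOrbitalIntegral_eq_zero (P : G → Prop) (S : Finset (ConjClasses G))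
    (hS : ∀ c, c ∈ S ↔ P (Quotient.out c)) (hP : ∀ g x : G, P (x * g * x⁻¹) ↔ P g)
    (hfilt : ∃ (n : ℕ) (e : Fin n → ConjClasses G), (∀ c, c ∈ S ↔ ∃ i, e i = c) ∧ ∀ k : ℕ, IsClosed (⋃ (i : Fin n) (_ : i.val < k), (e i).carrier))
    (mU : OrbitalMeasureFamily G) (hmU : mU.IsAdmissibleOn (fun γ : G => ConjClasses.mk γ ∈ S))
    (hRao : ∀ u ∈ S, ∀ f : G → ℂ, IsLocSmooth f →
      Integrable (descConj (Quotient.out u : G) (Subgroup.centralizer ({(Quotient.out u : G)} : Set G)) (fun _ hg => Subgroup.mem_centralizer_singleton_iff.1 hg) f) (mU u))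
    (F : G → ℂ) (hF : IsLocSmooth F) (h0 : ∀ u ∈ S, classOrbitalIntegral mU F u = 0) :
    ∃ F₀ F₁ : G → ℂ, F = F₀ + F₁ ∧ F₀ ∈ Submodule.span ℂ {ψ : G → ℂ | ∃ (x : G) (φ : G → ℂ), IsLocSmooth φ ∧ ψ = (fun g => φ (x * g * x⁻¹)) - φ} ∧
      ∀ g ∈ tsupport F₁, ¬ P g := by
  obtain ⟨n, e, he, hclosed⟩ := hfilt
  obtain ⟨F₀, F₁, hFeq, hF₀, -, hdisj⟩ :=
    exists_add_mem_span_conj_sub_tsupport_disjoint_filtration S e he hclosed mU hmU hRao F hF h0 n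
  refine ⟨F₀, F₁, hFeq, hF₀, fun g hg hPg => ?_⟩
  -- `P g` ⇒ the class of `g` lies in `S` ⇒ `g ∈ ⋃_{i<n} 𝒪(e i)`
  have hconj : P (Quotient.out (ConjClasses.mk g)) := by
    obtain ⟨c, hc⟩ := isConj_iff.1 (ConjClasses.mk_eq_mk_iff_isConj.1 (Quotient.out_eq (ConjClasses.mk g)))
    rw [← hP (Quotient.out (ConjClasses.mk g)) c, hc]
    exact hPg
  obtain ⟨i, hi⟩ := (he _).1 ((hS _).2 hconj)
  have hgi : g ∈ (e i).carrier := ConjClasses.mem_carrier_iff_mk_eq.2 hi.symm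
  exact disjoint_left.1 hdisj hg (mem_iUnion₂.2 ⟨i, i.isLt, hgi⟩)

end Induction

/-! ## Consumer glue: conjugation-invariance of «`(ρ(γ) − 1)^k = 0`» -/

section Glue

/-- **Conjugation-invariance of the unipotency-type predicate `(γ − 1)^k = 0`** for units of a ring (e.g. `GL_N`): `((a b a⁻¹) − 1)^k = a (b − 1)^k a⁻¹` vanishes iff
`(b − 1)^k` does — the hypothesis `hP` of `exists_add_mem_span_conj_sub_of_classOrbitalIntegral_eq_zero` at `P γ := ((ρ γ) − 1)^k = 0` for any matrix representation `ρ`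
(the Shalika organ: `ρ = val`, `k = 3`). [cite: Rogawski1990, §3.9 Prop. 3.9.1 p. 32] -/
theorem units_val_conj_sub_one_pow_eq_zero_iff {M : Type*} [Ring M] (a b : Mˣ) (k : ℕ) :
    (((a * b * a⁻¹ : Mˣ) : M) - 1) ^ k = 0 ↔ ((b : M) - 1) ^ k = 0 := by
  have h : ((a * b * a⁻¹ : Mˣ) : M) - 1 = (a : M) * ((b : M) - 1) * (↑a⁻¹ : M) := by
    rw [Units.val_mul, Units.val_mul, mul_sub, sub_mul, mul_one, Units.mul_inv]
  rw [h, Units.conj_pow, Units.mul_left_eq_zero, Units.mul_right_eq_zero]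

/-- The same for a group `G` mapped to units by a monoid hom `ρ` (e.g. the inclusion of `U(Φ₃)(L⁺_v)` in `GL₃`): `P γ := ((ρ γ : M) − 1)^k = 0` is conjugation-invariant.
[cite: Rogawski1990, §3.9 Prop. 3.9.1 p. 32] -/
theorem conj_invariant_val_sub_one_pow_eq_zero {G : Type*} [Group G] {M : Type*} [Ring M] (ρ : G →* Mˣ) (k : ℕ) (g x : G) :
    (((ρ (x * g * x⁻¹) : Mˣ) : M) - 1) ^ k = 0 ↔ (((ρ g : Mˣ) : M) - 1) ^ k = 0 := by
  rw [map_mul, map_mul, map_inv]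
  exact units_val_conj_sub_one_pow_eq_zero_iff (ρ x) (ρ g) k

end Glue

end Literature.MeasureTheory.Group

end
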